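import Summits.BirchSwinnertonDyer.BirchSwinnertonDyer.Theorems.ResidualThetaTransportAtTwoPlusDualEigenCount
import HarnessLib

/-!
# Kim 2007 Prop. 3.15 — the LAYER ALGEBRA of a cofree rank-one dual pair: joint kernels `S[p^J, Ψ]`, their exact orders
# `#Λ/(p^J, q)`, and the cofree calculus `Ψ_f · S[p^J, Ψ_g Ψ_f] = S[p^J, Ψ_g]`, `p · S[p^{J+1}, Ψ] = S[p^J, Ψ]`

Routes `ResidualThetaTransportAtTwo` (RTT, crux r201 `ResidualLambdaFormulaNegDiscAtTwo`, stmt-BirchSwinnertonDyer-23110) /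
`ThetaPartnerAtTwo`. Seat `prover-bsd-wall-tp2-p2x-w3` g13; `--supports stmt-BirchSwinnertonDyer-23110`. THEOREMS ONLY (no definition,
no named fact, no instance, no `sorry`); PURE ALGEBRA (no cohomology, no Galois theory, no points); closes nothing.

WHY. The last named input of item 23110 is `hdual_Alt(u)` (doors p666195 / p667231), reduced by w2 (`plusDualAlt_of_iso`) to ISO =
B. D. Kim, Compositio Math. 143 (2007), **Prop. 3.15 / 3.18** read at `p = 2`, twisted, at level `ℚ₂`. Kim's proof (pp. 56–57) runs on the
discrete side `H_n := H^{Gal(k_∞/k_n)} ≅ Hom(Λ/ω_n, ℚ_p/ℤ_p)` of a module `H` with `H^∨ ≅ Λ` (his Prop. 3.17; in the tree (R1)@2 =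
`PlusDual.nonempty_linearEquiv_iwasawaAlgebra_two`, p660566, for `H = (⋃ₙ E⁺(ℚ_{2,n})) ⊗ ℚ₂/ℤ₂`) and uses, besides the arithmetic of the
points, ONLY module-theoretic facts about such an `H`, proved here once and for all in the (R1) currency `IsDualPair p ψ toDual`
(`toDual : X ≅ Hom(S, ℚ/ℤ)`, `T ↦ ψ`) + `X ≃ₗ[Λ] Λ`, for ANY prime `p`:

* §1 (any commutative `R`, any dual pair) **`X/(q₁,…,q_n)X ≃+ Hom(⋂ᵢ ker Ψᵢ, ℚ/ℤ)`** when each `qᵢ` acts on `X` as the transpose of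
  `Ψᵢ ∈ End(S)` (`exists_quot_addEquiv_characterModule_iInf_ker`; `n = 1` is `PontryaginCard.exists_quotSMulTop_addEquiv_characterModule_ker`):
  a character killing `⋂ ker Ψᵢ = ker (s ↦ (Ψᵢ s)ᵢ)` factors through `S → Sⁿ` and extends (Tate's Lemma z.3). Counted: `#⋂ᵢ ker Ψᵢ = #X/(qᵢ)ᵢX`.
* §2 (`Λ = ℤ_p⟦T⟧`, `X ≃ₗ Λ`) **`#S[p^J, Ψ] = #Λ/(q, p^J)`** for every transposed pair `(q, Ψ)` (`natCard_torsionBy_ker_eq_natCard_quotient`),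
  hence **`= p^{J·deg D}`** when `(q) = (D)`, `D` distinguished (`natCard_torsionBy_ker_eq_pow`; Kim: «an explicit computation shows
  `#H_n[p^j] = p^{jdp^n}`»). The case `deg D = 1` is w2's `PlusDual.natCard_torsionBy_eigen_eq_pow` (p664149).
* §3 THE COFREE CALCULUS (counting only, `map_eq_of_card_eq_mul`): for transposed pairs `(f, Ψ_f)`, `(g, Ψ_g)` with distinguished
  generators, **`Ψ_f '' S[p^J, Ψ_g ∘ Ψ_f] = S[p^J, Ψ_g]`** (`image_torsionBy_ker_comp_eq`) — Kim's step (d) `Cor^m_n(H_m[p^j]) = H_n[p^j]` is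
  `f = ω_m/ω_n`, `g = ω_n`; his `ω_n H_n = H_n[ω̃_n]` is `f = ω^∓_n`, `g = ω̃^±_n`; the twisted «invariants = norms» of the level-`0`/level-`m`
  comparison is `f = ∑_{i<p^m} cⁱ(1+T)ⁱ`, `g = c(1+T) − 1` — and **`p · S[p^{J+1}, Ψ] = S[p^J, Ψ]`** (`nsmul_image_torsionBy_ker_succ_eq`,
  divisibility of `S[q]` read at finite level).

HONEST FRAMING: closes nothing; ISO / `hdual_Alt` are NOT proved here; 23110 is NOT proved; BSD is not proved by any of this.
References: [BDKim2007] Prop. 3.15 (proof, pp. 56–57), Prop. 3.17, Prop. 3.18; [GreenbergLNM1716] §1 p. 60, §4 p. 98;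
[Washington1997] §7.1, §13.2 (Prop. 13.8); [Tate1966Bourbaki] §5 Lemma z.3.
-/

set_option autoImplicit false
-- D-0017: single-problem summit, so `Summit.BirchSwinnertonDyer.BirchSwinnertonDyer.…` repeats a namespace BY DESIGN.
set_option linter.dupNamespace false

noncomputable section

open scoped Classical
open Literature.NumberTheory.EllipticCurves Literature.NumberTheory.EllipticCurves.IwasawaDual

namespace Summit.BirchSwinnertonDyer.BirchSwinnertonDyer.Theorems.ResidualThetaLayer.PlusDual

/-! ## §1 Pontryagin duality for several transposed pairs at once -/

section MultiTranspose

variable {R : Type*} [CommRing R] {X : Type*} [AddCommGroup X] [Module R X] {S : Type*} [AddCommGroup S]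
variable {ι : Type*} [Fintype ι]

/-- **Injectivity modulo `(q₁, …, q_n)`.** In a dual pair `toDual : X ≅ Hom(S, ℚ/ℤ)` in which each `qᵢ ∈ R` acts on `X` as the
transpose of `Ψᵢ ∈ End(S)`, a character `toDual x` killing `⋂ᵢ ker Ψᵢ` is `toDual (∑ᵢ qᵢ • xᵢ)`: `x ∈ (q₁, …, q_n)X` (factor `toDual x`
through `s ↦ (Ψᵢ s)ᵢ : S → Sⁿ`, extend to `Sⁿ` by the injectivity of `ℚ/ℤ`, and split the extension into its `n` components).
[cite: Tate1966Bourbaki, §5 Lemma z.3] [cite: GreenbergLNM1716, §4 p. 98] -/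
theorem mem_ideal_span_smul_top_of_forall_iInf_ker (toDual : X →+ CharacterModule S) (hbij : Function.Bijective toDual)
    (q : ι → R) (Ψ : ι → (S →+ S)) (hq : ∀ (i : ι) (x : X) (s : S), toDual (q i • x) s = toDual x (Ψ i s))
    {x : X} (hx : ∀ s : S, (∀ i, Ψ i s = 0) → toDual x s = 0) :
    x ∈ (Ideal.span (Set.range q) : Ideal R) • (⊤ : Submodule R X) := by
  let Φ : S →ₗ[ℤ] (ι → S) := LinearMap.pi fun i ↦ (Ψ i).toIntLinearMap
  have hΦ : ∀ (s : S) (i : ι), Φ s i = Ψ i s := fun _ _ ↦ rfl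
  have hzero : CharacterModule.dual (R := ℤ) (LinearMap.ker Φ).subtype (toDual x) = 0 := by
    refine CharacterModule.ext (A := ↥(LinearMap.ker Φ)) fun s ↦ ?_
    have h0 : Φ s.1 = 0 := s.2
    exact hx s.1 fun i ↦ by rw [← hΦ, h0]; rfl
  obtain ⟨χ, hχ⟩ := ((TateBourbaki.exact_dual_dual_kerSubtype (R := ℤ) Φ) (toDual x)).mp hzero
  -- the components `χ ∘ singleᵢ` of the extension are characters `toDual yᵢ`
  have hcomp : ∀ i, ∃ y : X, toDual y =
      (χ : (ι → S) →+ AddCircle (1 : ℚ)).comp (AddMonoidHom.single (fun _ : ι ↦ S) i) := fun i ↦ hbij.2 _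
  choose y hy using hcomp
  have hxy : x = ∑ i, q i • y i := by
    apply hbij.1
    refine CharacterModule.ext (A := S) fun s ↦ ?_
    have e1 : toDual x s = χ (Φ s) := by rw [← hχ]; rfl
    have e2 : Φ s = ∑ i, Pi.single i (Ψ i s) := by
      conv_lhs => rw [← Finset.univ_sum_single (Φ s)]
      rfl
    have e3 : ∀ i, χ (Pi.single i (Ψ i s)) = toDual (y i) (Ψ i s) := fun i ↦ by rw [hy i]; rfl
    -- evaluation of a finite sum of characters
    have e4 : (∑ i, toDual (q i • y i)) s = ∑ i, toDual (q i • y i) s :=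
      AddMonoidHom.finsetSum_apply (fun i ↦ (toDual (q i • y i) : S →+ AddCircle (1 : ℚ))) Finset.univ s
    rw [e1, e2, map_sum, map_sum, e4]
    exact Finset.sum_congr rfl fun i _ ↦ by rw [e3, hq]
  rw [hxy]
  exact Submodule.sum_mem _ fun i _ ↦ Submodule.smul_mem_smul (Ideal.subset_span ⟨i, rfl⟩) Submodule.mem_top

/-- **`X/(q₁, …, q_n)X ≃+ Hom(⋂ᵢ ker Ψᵢ, ℚ/ℤ)` by restriction of characters** (any commutative `R`, any dual pair `toDual : X ≅
Hom(S, ℚ/ℤ)` with `qᵢ` the transpose of `Ψᵢ`): restriction kills `qᵢX` (`toDual (qᵢ x) a = toDual x (Ψᵢ a) = 0`), is injective modulo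
`(qᵢ)ᵢX` (`mem_ideal_span_smul_top_of_forall_iInf_ker`) and onto (characters of a subgroup extend). Greenberg's «`X/θ_n X` is the Pontryagin
dual of `Sel^{Γ_n}`» for several `θ`'s at once; the case `n = 1` is `PontryaginCard.exists_quotSMulTop_addEquiv_characterModule_ker`.
[cite: GreenbergLNM1716, §4 p. 98 and §1 p. 60] [cite: Tate1966Bourbaki, §5 Lemma z.3] -/
theorem exists_quot_addEquiv_characterModule_iInf_ker (toDual : X →+ CharacterModule S) (hbij : Function.Bijective toDual)
    (q : ι → R) (Ψ : ι → (S →+ S)) (hq : ∀ (i : ι) (x : X) (s : S), toDual (q i • x) s = toDual x (Ψ i s)) :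
    ∃ Φq : (X ⧸ ((Ideal.span (Set.range q) : Ideal R) • (⊤ : Submodule R X))) ≃+ CharacterModule ↥(⨅ i, (Ψ i).ker),
      ∀ (x : X) (a : ↥(⨅ i, (Ψ i).ker)), Φq (Submodule.Quotient.mk x) a = toDual x a := by
  set K : AddSubgroup S := ⨅ i, (Ψ i).ker with hK
  have hmemK : ∀ {s : S}, s ∈ K ↔ ∀ i, Ψ i s = 0 := fun {s} ↦ by
    rw [hK, AddSubgroup.mem_iInf]; simp only [AddMonoidHom.mem_ker]
  let R₀ : X →+ CharacterModule ↥K :=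
    { toFun := fun x ↦ (toDual x : S →+ AddCircle (1 : ℚ)).comp K.subtype
      map_zero' := by rw [map_zero]; rfl
      map_add' := fun x y ↦ by rw [map_add]; rfl }
  have hR₀ : ∀ (x : X) (a : K), R₀ x a = toDual x a := fun _ _ ↦ rfl
  -- `R₀` kills `(qᵢ)ᵢ X`
  have hspan : ∀ r ∈ (Ideal.span (Set.range q) : Ideal R), ∀ x : X, R₀ (r • x) = 0 := by
    intro r hr
    refine Submodule.span_induction (p := fun r _ ↦ ∀ x : X, R₀ (r • x) = 0) ?_ ?_ ?_ ?_ hr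
    · rintro _ ⟨i, rfl⟩ x
      refine CharacterModule.ext (A := ↥K) fun a ↦ ?_
      rw [hR₀, hq, (hmemK.mp a.2) i, map_zero]
      rfl
    · intro x
      rw [zero_smul, map_zero]
    · intro r₁ r₂ _ _ h₁ h₂ x
      rw [add_smul, map_add, h₁ x, h₂ x, add_zero]
    · intro c r _ hr' x
      rw [smul_eq_mul, mul_comm, mul_smul]
      exact hr' (c • x)
  have hker : ((Ideal.span (Set.range q) : Ideal R) • (⊤ : Submodule R X)).toAddSubgroup ≤ R₀.ker := by
    intro y hy
    rw [Submodule.mem_toAddSubgroup] at hy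
    refine Submodule.smul_induction_on hy (fun r hr x _ ↦ (AddMonoidHom.mem_ker).mpr (hspan r hr x)) fun a b ha hb ↦ ?_
    rw [AddMonoidHom.mem_ker] at ha hb ⊢
    rw [map_add, ha, hb, add_zero]
  let Rq : (X ⧸ ((Ideal.span (Set.range q) : Ideal R) • (⊤ : Submodule R X))) →+ CharacterModule ↥K :=
    QuotientAddGroup.lift _ R₀ hker
  have hRq : ∀ x : X, Rq (Submodule.Quotient.mk x) = R₀ x := fun _ ↦ rfl
  have hbijq : Function.Bijective Rq := by
    constructor
    · rw [injective_iff_map_eq_zero]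
      intro z hz
      induction z using Submodule.Quotient.induction_on with
      | H x =>
        rw [hRq] at hz
        have hx : ∀ s : S, (∀ i, Ψ i s = 0) → toDual x s = 0 := fun s hs ↦ by
          have := DFunLike.congr_fun hz ⟨s, hmemK.mpr hs⟩
          rwa [hR₀] at this
        rw [Submodule.Quotient.mk_eq_zero]
        exact mem_ideal_span_smul_top_of_forall_iInf_ker toDual hbij q Ψ hq hx
    · intro χ
      obtain ⟨χ', hχ'⟩ := CharacterModule.dual_surjective_of_injective (R := ℤ)
        K.subtype.toIntLinearMap (fun a b hab ↦ Subtype.ext hab) χ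
      obtain ⟨x, hx⟩ := hbij.2 χ'
      refine ⟨Submodule.Quotient.mk x, ?_⟩
      rw [hRq]
      refine CharacterModule.ext (A := ↥K) fun a ↦ ?_
      rw [hR₀, hx, ← hχ']
      rfl
  exact ⟨AddEquiv.ofBijective Rq hbijq, fun x a ↦ rfl⟩

/-- **`#⋂ᵢ ker Ψᵢ = #X/(q₁, …, q_n)X`** (as `Nat.card`, both sides `0` when infinite) for a dual pair in which `qᵢ` is the transpose of
`Ψᵢ`. [cite: GreenbergLNM1716, §4 p. 98] [cite: Tate1966Bourbaki, §5 Lemma z.3] -/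
theorem natCard_iInf_ker_eq_natCard_quot (toDual : X →+ CharacterModule S) (hbij : Function.Bijective toDual)
    (q : ι → R) (Ψ : ι → (S →+ S)) (hq : ∀ (i : ι) (x : X) (s : S), toDual (q i • x) s = toDual x (Ψ i s)) :
    Nat.card ↥(⨅ i, (Ψ i).ker) = Nat.card (X ⧸ ((Ideal.span (Set.range q) : Ideal R) • (⊤ : Submodule R X))) := by
  obtain ⟨Φq, -⟩ := exists_quot_addEquiv_characterModule_iInf_ker toDual hbij q Ψ hq
  rw [Nat.card_congr Φq.toEquiv, PontryaginCard.natCard_characterModule]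

end MultiTranspose

/-! ## §2 Exact orders `#S[p^J, Ψ] = #Λ/(q, p^J)` for a cofree rank-one dual pair -/

section Count

variable {p : ℕ} [Fact p.Prime]
variable {S : Type*} [AddCommGroup S] {ψ : AddMonoid.End S}
variable {X : Type*} [AddCommGroup X] [Module (PowerSeries ℤ_[p]) X]
variable {toDual : X →+ (S →+ AddCircle (1 : ℚ))}

/-- **`#S[p^J, Ψ] = #Λ/(q, p^J)`** (as `Nat.card`). For a dual pair `(X, toDual)` of `S` with `X ≃ₗ[Λ] Λ` and an element `q ∈ Λ`
acting on `X` as the transpose of an additive `Ψ : S → S`, the joint kernel `{s : p^J s = 0, Ψ s = 0}` is Pontryagin dual to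
`Λ/(q, p^J)` (`natCard_iInf_ker_eq_natCard_quot` for the two pairs `(C p^J, p^J•)`, `(q, Ψ)`, transported along `X ≃ₗ Λ`).
[cite: BDKim2007, Prop. 3.15 (proof, «an explicit computation shows»)] [cite: GreenbergLNM1716, §4 p. 98] -/
theorem natCard_torsionBy_ker_eq_natCard_quotient (h : IsDualPair p ψ toDual)
    (e : X ≃ₗ[PowerSeries ℤ_[p]] PowerSeries ℤ_[p]) (q : PowerSeries ℤ_[p]) (Ψ : S →+ S)
    (hq : ∀ (x : X) (s : S), toDual (q • x) s = toDual x (Ψ s)) (J : ℕ) :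
    Nat.card {s : S // p ^ J • s = 0 ∧ Ψ s = 0} =
      Nat.card (PowerSeries ℤ_[p] ⧸
        (Ideal.span {q} ⊔ Ideal.span {PowerSeries.C ((p : ℤ_[p]) ^ J)} : Ideal (PowerSeries ℤ_[p]))) := by
  -- transport the dual pair to `Λ`
  let d : PowerSeries ℤ_[p] →+ (S →+ AddCircle (1 : ℚ)) := toDual.comp e.symm.toLinearMap.toAddMonoidHom
  have hd : ∀ (f : PowerSeries ℤ_[p]) (s : S), d f s = toDual (e.symm f) s := fun _ _ ↦ rfl
  have hdbij : Function.Bijective d := h.bijective.comp e.symm.bijective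
  have hpJ : (PowerSeries.C ((p : ℤ_[p]) ^ J) : PowerSeries ℤ_[p]) = ((p ^ J : ℕ) : PowerSeries ℤ_[p]) := by
    rw [map_pow, map_natCast, Nat.cast_pow]
  -- the two transposed pairs `(C p^J, p^J •)` and `(q, Ψ)`
  let qv : Fin 2 → PowerSeries ℤ_[p] := ![PowerSeries.C ((p : ℤ_[p]) ^ J), q]
  let Ψv : Fin 2 → (S →+ S) := ![DistribSMul.toAddMonoidHom S (p ^ J), Ψ]
  have hqv : ∀ (i : Fin 2) (f : PowerSeries ℤ_[p]) (s : S), d (qv i • f) s = d f (Ψv i s) := by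
    intro i f s
    fin_cases i
    · show d (PowerSeries.C ((p : ℤ_[p]) ^ J) • f) s = d f (p ^ J • s)
      rw [hd, hd, map_smul, hpJ, Nat.cast_smul_eq_nsmul, nsmul_eval]
    · show d (q • f) s = d f (Ψ s)
      rw [hd, hd, map_smul, hq]
  have hcount := natCard_iInf_ker_eq_natCard_quot d hdbij qv Ψv hqv
  -- identify the two sides
  have hl : Nat.card ↥(⨅ i, (Ψv i).ker) = Nat.card {s : S // p ^ J • s = 0 ∧ Ψ s = 0} := by
    refine Nat.card_congr (Equiv.subtypeEquivRight fun s ↦ ?_)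
    rw [AddSubgroup.mem_iInf, Fin.forall_fin_two]
    rfl
  have hrange : Set.range qv = {PowerSeries.C ((p : ℤ_[p]) ^ J), q} := by
    simp only [qv, Matrix.range_cons, Matrix.range_empty, Set.union_empty, Set.singleton_union]
  have hI : ((Ideal.span (Set.range qv) : Ideal (PowerSeries ℤ_[p])) • (⊤ : Submodule (PowerSeries ℤ_[p]) (PowerSeries ℤ_[p]))) =
      (Ideal.span {q} ⊔ Ideal.span {PowerSeries.C ((p : ℤ_[p]) ^ J)} : Ideal (PowerSeries ℤ_[p])) := by
    rw [hrange, Ideal.smul_eq_mul, Ideal.mul_top, Ideal.span_insert, sup_comm]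
  rw [← hl, hcount]
  exact Nat.card_congr (Submodule.quotEquivOfEq _ _ hI).toEquiv

/-- **`#S[p^J, Ψ] = p^{J·deg D}`** when, in a dual pair with `X ≃ₗ[Λ] Λ`, the transpose `q ∈ Λ` of `Ψ` generates the same ideal as a
DISTINGUISHED polynomial `D` (`Λ/(D, p^J)` has exactly `p^{J deg D}` elements, Washington Prop. 13.8 / the tree's
`IwasawaAlgebra.card_quotient_span_coe_sup_span_C_pow`). Kim: «an explicit computation shows that `H_n[p^j] ≅ (ℤ/p^jℤ)^{dpⁿ}`» is the case
`D = ω_n`; w2's `natCard_torsionBy_eigen_eq_pow` is `D = T − (c−1)`. [cite: BDKim2007, Prop. 3.15 (proof)] [cite: Washington1997, §13.2 (Prop. 13.8)] -/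
theorem natCard_torsionBy_ker_eq_pow (h : IsDualPair p ψ toDual) (e : X ≃ₗ[PowerSeries ℤ_[p]] PowerSeries ℤ_[p])
    {D : Polynomial ℤ_[p]} (hD : D.IsDistinguishedAt (IsLocalRing.maximalIdeal ℤ_[p])) {q : PowerSeries ℤ_[p]}
    (hqD : Ideal.span {q} = Ideal.span {(D : PowerSeries ℤ_[p])}) (Ψ : S →+ S)
    (hq : ∀ (x : X) (s : S), toDual (q • x) s = toDual x (Ψ s)) (J : ℕ) :
    Nat.card {s : S // p ^ J • s = 0 ∧ Ψ s = 0} = p ^ (J * D.natDegree) := by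
  rw [natCard_torsionBy_ker_eq_natCard_quotient h e q Ψ hq J, hqD,
    IwasawaAlgebra.card_quotient_span_coe_sup_span_C_pow p hD J]

/-- The joint kernel `S[p^J, Ψ]` of a transposed pair with distinguished generator is FINITE (its order is a power of `p`).
[cite: BDKim2007, Prop. 3.15 (proof)] -/
theorem finite_torsionBy_ker (h : IsDualPair p ψ toDual) (e : X ≃ₗ[PowerSeries ℤ_[p]] PowerSeries ℤ_[p])
    {D : Polynomial ℤ_[p]} (hD : D.IsDistinguishedAt (IsLocalRing.maximalIdeal ℤ_[p])) {q : PowerSeries ℤ_[p]}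
    (hqD : Ideal.span {q} = Ideal.span {(D : PowerSeries ℤ_[p])}) (Ψ : S →+ S)
    (hq : ∀ (x : X) (s : S), toDual (q • x) s = toDual x (Ψ s)) (J : ℕ) :
    {s : S | p ^ J • s = 0 ∧ Ψ s = 0}.Finite := by
  have hne : Nat.card {s : S // p ^ J • s = 0 ∧ Ψ s = 0} ≠ 0 := by
    rw [natCard_torsionBy_ker_eq_pow h e hD hqD Ψ hq J]
    exact pow_ne_zero _ (Fact.out : p.Prime).ne_zero
  exact Set.finite_coe_iff.mp (Nat.finite_of_card_ne_zero hne)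

end Count

/-! ## §3 The cofree calculus: `Ψ_f · S[p^J, Ψ_g Ψ_f] = S[p^J, Ψ_g]` and `p · S[p^{J+1}, Ψ] = S[p^J, Ψ]` -/

section Cofree

variable {S : Type*} [AddCommGroup S]

/-- **Counting engine.** An additive `Θ` mapping a finite subgroup `A` into a subgroup `B` with `#A = #B · #(A ∩ ker Θ)` maps `A`
ONTO `B`: `#Θ(A) = #A / #(A ∩ ker Θ) = #B` and `Θ(A) ≤ B`. [folklore] -/
theorem map_eq_of_card_eq_mul (Θ : S →+ S) (A B : AddSubgroup S) [Finite A] [Finite B] (hle : A.map Θ ≤ B)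
    (hcard : Nat.card A = Nat.card B * Nat.card ↥(A ⊓ Θ.ker)) : A.map Θ = B := by
  -- `#A = #Θ(A) · #ker(Θ|_A)` and `ker(Θ|_A) ≃ A ⊓ ker Θ`
  have hres : (Θ.restrict A).range = A.map Θ := AddMonoidHom.restrict_range A Θ
  have hkerEquiv : Nat.card (Θ.restrict A).ker = Nat.card ↥(A ⊓ Θ.ker) := by
    refine Nat.card_congr
      { toFun := fun x ↦ ⟨(x.1 : S), AddSubgroup.mem_inf.mpr ⟨x.1.2, ?_⟩⟩
        invFun := fun y ↦ ⟨⟨y.1, (AddSubgroup.mem_inf.mp y.2).1⟩, ?_⟩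
        left_inv := fun x ↦ rfl
        right_inv := fun y ↦ rfl }
    · have hx := x.2
      rw [AddMonoidHom.mem_ker] at hx ⊢
      exact hx
    · rw [AddMonoidHom.mem_ker]
      exact (AddSubgroup.mem_inf.mp y.2).2
  have hA : Nat.card A = Nat.card (A.map Θ) * Nat.card ↥(A ⊓ Θ.ker) := by
    rw [AddSubgroup.card_eq_card_quotient_mul_card_addSubgroup (Θ.restrict A).ker, hkerEquiv,
      Nat.card_congr (QuotientAddGroup.quotientKerEquivRange (Θ.restrict A)).toEquiv, hres]
  have hk : Nat.card ↥(A ⊓ Θ.ker) ≠ 0 := by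
    haveI : Finite ↥(A ⊓ Θ.ker) := Finite.of_injective (fun y : ↥(A ⊓ Θ.ker) ↦ (⟨y.1, (AddSubgroup.mem_inf.mp y.2).1⟩ : A))
      fun a b hab ↦ Subtype.ext (congrArg (fun z : A ↦ (z : S)) hab)
    exact Nat.card_pos.ne'
  have hcardeq : Nat.card (A.map Θ) = Nat.card B :=
    mul_right_cancel₀ hk (hA.symm.trans hcard)
  exact AddSubgroup.eq_of_le_of_card_ge hle hcardeq.symm.le

variable {p : ℕ} [Fact p.Prime] {ψ : AddMonoid.End S}
variable {X : Type*} [AddCommGroup X] [Module (PowerSeries ℤ_[p]) X]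
variable {toDual : X →+ (S →+ AddCircle (1 : ℚ))}

/-- Products of transposed pairs: if `f` acts as the transpose of `Ψ_f` and `g` as that of `Ψ_g`, then `f·g` acts as the transpose
of `Ψ_g ∘ Ψ_f`. [folklore] -/
theorem transpose_mul {f g : PowerSeries ℤ_[p]} {Ψf Ψg : S →+ S}
    (hΨf : ∀ (x : X) (s : S), toDual (f • x) s = toDual x (Ψf s))
    (hΨg : ∀ (x : X) (s : S), toDual (g • x) s = toDual x (Ψg s)) (x : X) (s : S) :
    toDual ((f * g) • x) s = toDual x ((Ψg.comp Ψf) s) := by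
  rw [mul_smul, hΨf, hΨg, AddMonoidHom.comp_apply]

/-- **`Ψ_f '' S[p^J, Ψ_g ∘ Ψ_f] = S[p^J, Ψ_g]`** — the cofree calculus of a rank-one dual pair. For transposed pairs `(f, Ψ_f)`, `(g, Ψ_g)`
whose transposes generate the ideals of DISTINGUISHED polynomials `D_f`, `D_g`: `Ψ_f` maps the joint kernel of `(p^J, Ψ_g Ψ_f)` (order
`p^{J(deg D_f + deg D_g)}`, transpose `fg`) ONTO that of `(p^J, Ψ_g)` (order `p^{J deg D_g}`), its kernel there being `S[p^J, Ψ_f]` (order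
`p^{J deg D_f}`) — pure counting (`map_eq_of_card_eq_mul`). Instances: Kim's COR-SURJECTIVITY `Cor^m_n(H_m[p^j]) = H_n[p^j]` (`f = ω_m/ω_n`,
`g = ω_n`, `Ψ_f` = the norm `∑_{i<p^{m−n}} φ^{ipⁿ}`), his `ω_n H_n = H_n[ω̃_n]`, and the twisted «invariants = norms»
(`f = ∑_{i<p^m} cⁱ(1+T)ⁱ`, `g = c(1+T) − 1`). [cite: BDKim2007, Prop. 3.15 (proof, pp. 56–57)] [cite: Washington1997, §13.2 (Prop. 13.8)] -/
theorem image_torsionBy_ker_comp_eq (h : IsDualPair p ψ toDual) (e : X ≃ₗ[PowerSeries ℤ_[p]] PowerSeries ℤ_[p])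
    {Df Dg : Polynomial ℤ_[p]} (hDf : Df.IsDistinguishedAt (IsLocalRing.maximalIdeal ℤ_[p]))
    (hDg : Dg.IsDistinguishedAt (IsLocalRing.maximalIdeal ℤ_[p])) {f g : PowerSeries ℤ_[p]}
    (hf : Ideal.span {f} = Ideal.span {(Df : PowerSeries ℤ_[p])}) (hg : Ideal.span {g} = Ideal.span {(Dg : PowerSeries ℤ_[p])})
    {Ψf Ψg : S →+ S} (hΨf : ∀ (x : X) (s : S), toDual (f • x) s = toDual x (Ψf s))
    (hΨg : ∀ (x : X) (s : S), toDual (g • x) s = toDual x (Ψg s)) (J : ℕ) :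
    Ψf '' {s : S | p ^ J • s = 0 ∧ Ψg (Ψf s) = 0} = {s : S | p ^ J • s = 0 ∧ Ψg s = 0} := by
  -- the three joint kernels as subgroups
  let K : (S →+ S) → AddSubgroup S := fun Θ ↦ (DistribSMul.toAddMonoidHom S (p ^ J)).ker ⊓ Θ.ker
  have hK : ∀ (Θ : S →+ S) (s : S), s ∈ K Θ ↔ p ^ J • s = 0 ∧ Θ s = 0 := fun Θ s ↦ by
    simp only [K, AddSubgroup.mem_inf, AddMonoidHom.mem_ker, DistribSMul.toAddMonoidHom_apply]
  have hKset : ∀ Θ : S →+ S, (K Θ : Set S) = {s : S | p ^ J • s = 0 ∧ Θ s = 0} := fun Θ ↦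
    Set.ext fun s ↦ by rw [SetLike.mem_coe, hK]; rfl
  have hKcard : ∀ Θ : S →+ S, Nat.card (K Θ) = Nat.card {s : S // p ^ J • s = 0 ∧ Θ s = 0} := fun Θ ↦
    Nat.card_congr (Equiv.subtypeEquivRight fun s ↦ hK Θ s)
  -- transposes and counts
  have hfg : Ideal.span {f * g} = Ideal.span {((Df * Dg : Polynomial ℤ_[p]) : PowerSeries ℤ_[p])} := by
    rw [← Ideal.span_singleton_mul_span_singleton, hf, hg, Ideal.span_singleton_mul_span_singleton, Polynomial.coe_mul]
  have hA : Nat.card (K (Ψg.comp Ψf)) = p ^ (J * Df.natDegree) * p ^ (J * Dg.natDegree) := by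
    rw [hKcard, natCard_torsionBy_ker_eq_pow h e (hDf.mul hDg) hfg (Ψg.comp Ψf) (transpose_mul hΨf hΨg) J,
      hDf.monic.natDegree_mul hDg.monic, mul_add, pow_add]
  have hB : Nat.card (K Ψg) = p ^ (J * Dg.natDegree) := by
    rw [hKcard, natCard_torsionBy_ker_eq_pow h e hDg hg Ψg hΨg J]
  have hC : Nat.card ↥(K (Ψg.comp Ψf) ⊓ Ψf.ker) = p ^ (J * Df.natDegree) := by
    rw [← natCard_torsionBy_ker_eq_pow h e hDf hf Ψf hΨf J]
    refine Nat.card_congr (Equiv.subtypeEquivRight fun s ↦ ?_)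
    rw [AddSubgroup.mem_inf, hK, AddMonoidHom.mem_ker, AddMonoidHom.comp_apply]
    constructor
    · rintro ⟨⟨h1, -⟩, h2⟩; exact ⟨h1, h2⟩
    · rintro ⟨h1, h2⟩; exact ⟨⟨h1, by rw [h2, map_zero]⟩, h2⟩
  haveI : Finite (K (Ψg.comp Ψf)) := Nat.finite_of_card_ne_zero (by
    rw [hA]; exact mul_ne_zero (pow_ne_zero _ (Fact.out : p.Prime).ne_zero) (pow_ne_zero _ (Fact.out : p.Prime).ne_zero))
  haveI : Finite (K Ψg) := Nat.finite_of_card_ne_zero (by rw [hB]; exact pow_ne_zero _ (Fact.out : p.Prime).ne_zero)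
  have hle : (K (Ψg.comp Ψf)).map Ψf ≤ K Ψg := by
    rintro _ ⟨s, hs, rfl⟩
    rw [SetLike.mem_coe, hK] at hs
    rw [hK, ← map_nsmul, hs.1, map_zero]
    exact ⟨rfl, hs.2⟩
  have hmap := map_eq_of_card_eq_mul Ψf (K (Ψg.comp Ψf)) (K Ψg) hle (by rw [hA, hB, hC, mul_comm])
  have := congrArg (fun H : AddSubgroup S ↦ (H : Set S)) hmap
  simpa only [AddSubgroup.coe_map, hKset, AddMonoidHom.coe_comp, Function.comp_apply] using this

/-- **`p · S[p^{J+1}, Ψ] = S[p^J, Ψ]`** — divisibility of `S[q] ≅ Hom(Λ/q, ℚ_p/ℤ_p)` read at finite level: for a transposed pair `(q, Ψ)`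
with `(q) = (D)` distinguished, multiplication by `p` maps `S[p^{J+1}, Ψ]` (order `p^{(J+1) deg D}`) ONTO `S[p^J, Ψ]` (order `p^{J deg D}`),
its kernel being `S[p, Ψ]` (order `p^{deg D}`). Kim: «since `H_n` is divisible…». [cite: BDKim2007, Prop. 3.15 (proof)]
[cite: Washington1997, §13.2 (Prop. 13.8)] -/
theorem nsmul_image_torsionBy_ker_succ_eq (h : IsDualPair p ψ toDual) (e : X ≃ₗ[PowerSeries ℤ_[p]] PowerSeries ℤ_[p])
    {D : Polynomial ℤ_[p]} (hD : D.IsDistinguishedAt (IsLocalRing.maximalIdeal ℤ_[p])) {q : PowerSeries ℤ_[p]}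
    (hqD : Ideal.span {q} = Ideal.span {(D : PowerSeries ℤ_[p])}) {Ψ : S →+ S}
    (hq : ∀ (x : X) (s : S), toDual (q • x) s = toDual x (Ψ s)) (J : ℕ) :
    (fun s : S ↦ p • s) '' {s : S | p ^ (J + 1) • s = 0 ∧ Ψ s = 0} = {s : S | p ^ J • s = 0 ∧ Ψ s = 0} := by
  let K : ℕ → AddSubgroup S := fun j ↦ (DistribSMul.toAddMonoidHom S (p ^ j)).ker ⊓ Ψ.ker
  have hK : ∀ (j : ℕ) (s : S), s ∈ K j ↔ p ^ j • s = 0 ∧ Ψ s = 0 := fun j s ↦ by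
    simp only [K, AddSubgroup.mem_inf, AddMonoidHom.mem_ker, DistribSMul.toAddMonoidHom_apply]
  have hKset : ∀ j : ℕ, (K j : Set S) = {s : S | p ^ j • s = 0 ∧ Ψ s = 0} := fun j ↦
    Set.ext fun s ↦ by rw [SetLike.mem_coe, hK]; rfl
  have hKcard : ∀ j : ℕ, Nat.card (K j) = p ^ (j * D.natDegree) := fun j ↦ by
    rw [← natCard_torsionBy_ker_eq_pow h e hD hqD Ψ hq j]
    exact Nat.card_congr (Equiv.subtypeEquivRight fun s ↦ hK j s)
  let Θ : S →+ S := DistribSMul.toAddMonoidHom S p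
  have hΘ : ∀ s : S, Θ s = p • s := fun _ ↦ rfl
  have hC : Nat.card ↥(K (J + 1) ⊓ Θ.ker) = p ^ (1 * D.natDegree) := by
    rw [← hKcard 1]
    refine Nat.card_congr (Equiv.subtypeEquivRight fun s ↦ ?_)
    rw [AddSubgroup.mem_inf, hK, hK, AddMonoidHom.mem_ker, hΘ, pow_one]
    constructor
    · rintro ⟨⟨-, h2⟩, h3⟩; exact ⟨h3, h2⟩
    · rintro ⟨h1, h2⟩; exact ⟨⟨by rw [pow_succ, mul_smul, h1, smul_zero], h2⟩, h1⟩
  haveI : ∀ j, Finite (K j) := fun j ↦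
    Nat.finite_of_card_ne_zero (by rw [hKcard]; exact pow_ne_zero _ (Fact.out : p.Prime).ne_zero)
  have hle : (K (J + 1)).map Θ ≤ K J := by
    rintro _ ⟨s, hs, rfl⟩
    rw [SetLike.mem_coe, hK] at hs
    rw [hK, hΘ, map_nsmul, hs.2, smul_zero, ← mul_smul, ← pow_succ]
    exact ⟨hs.1, rfl⟩
  have hmap := map_eq_of_card_eq_mul Θ (K (J + 1)) (K J) hle (by
    rw [hKcard, hKcard, hC, ← pow_add]; congr 1; ring)
  have hΘfun : (Θ : S → S) = fun s ↦ p • s := rfl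
  have := congrArg (fun H : AddSubgroup S ↦ (H : Set S)) hmap
  rw [AddSubgroup.coe_map, hKset, hKset, hΘfun] at this
  exact this

end Cofree


end Summit.BirchSwinnertonDyer.BirchSwinnertonDyer.Theorems.ResidualThetaLayer.PlusDual

end
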